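import Summits.CriticalPhenomena.SAWScalingLimit.Theorems.SAWTotalPositivityCriticalBubbleBoundDockingInjection

/-!
# The unflip `U_i ≤ 2 x_c · D_i^{wide}` (line `docking-census-joining`, stub `pinchMass_le_two_mul_wideDockMass`)

Crux `stmt-CriticalPhenomena-7117`
(`Summit.CriticalPhenomena.SAWScalingLimit.Theses.SAWTotalPositivity.CriticalBubbleBound`), line
`docking-census-joining`, registered stub `pinchMass_le_two_mul_wideDockMass` ("the unflip
direction"); objects `dockings`, `pinches`, `pinchMass` of
`…Theorems.SAWTotalPositivityCriticalBubbleBoundDockingDefs`. Converse of the landed docking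
injection `stub_dockingInjection` (`dockMass i ≤ x_c⁻¹ · pinchMass i`): together they make the
correspondence "docking datum ↔ (rooted polygon, macroscopic pinch plaquette)" two-sided.

**Statement.** For every scale `i`,
`pinchMass i ≤ 2 x_c · Σ_{j,k ∈ [2^i, 2^{i+2})} Σ_{ω,ω'} |dockings j k ω ω'| x_c^j x_c^k`.

**Proof (the unflip).** Fix `n ∈ B_{i+1}`, `χ ∈ sawFun 2 n e₀` and a pinch plaquette `q` of `χ` with
witnesses `E₁ ∋ rootEdge`, `E₂` (vertex-disjoint polygons, `E₁ ∪ E₂` = the flip of `P = pedges n χ`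
at `q`, both with `≥ 2^i + 1` edges).
* sizes (`pinch_unflip`): `|E₁| + |E₂| = |P| = n + 1`, so with `|E₁| = j + 1`, `|E₂| = k + 1` one has
  `n = j + k + 1` and `j, k ∈ [2^i, 2^{i+2})`;
* `E₁ = pedges j ω` for some `ω ∈ sawFun 2 j e₀` (opening at the root, `exists_sawFun_of_isPolygon`);
* each of `E₁`, `E₂` contains exactly one horizontal side of the plaquette (`pinch_not_both`): if one
  part contained both, the other part would be a polygon inside the polygon `P` avoiding the edge
  `{q, q+e₁}` of `P` — impossible, a polygon contains no other polygon (`polygon_eq_of_subset`, from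
  `eq_of_isPath_of_edges_subset`: a self-avoiding path is the only self-avoiding path between its
  ends inside its own edge set);
* the horizontal side lying in `E₂` is the root edge `{v, v+e₀}` of `E₂ = pedges k (shift v ω')`,
  `ω' ∈ sawFun 2 k e₀` (`exists_sawFun_shift_of_isPolygon`), and `v ∈ dockings j k ω ω'` (the other
  horizontal side is a non-root edge of `pedges j ω` facing it; vertex-disjointness);
* the orientation bit `o` (is the lower side the one in `E₂`?) and `v` recover `q`, and `E₁ ∪ E₂`, `q`
  recover `P` (inverse flip), hence `χ` (`eq_of_pedges_shift_eq`): the unflip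
  `(n, χ, q) ↦ (j, k, ω, ω', v, o)` is injective and carries the weight `x_c^n = x_c · x_c^j x_c^k`;
  summing gives the bound, the factor `2` paying for `o`.

Sources: A. Hammond, *An upper bound on the number of self-avoiding polygons via joining*, Ann.
Probab. 46 (2018), §4.1 (join plaquettes and their flips); N. Madras, G. Slade, *The Self-Avoiding
Walk* (1993), §1.4, Definition 3.2.1. Everything here is elementary combinatorics ([folklore]).
-/

noncomputable section

open Literature.Probability.LatticeModels
open Literature.Probability.RandomPlanarGeometry Literature.Probability.RandomPlanarGeometry.SAW
open scoped BigOperators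
open Summit.CriticalPhenomena.SAWScalingLimit.Theorems.CriticalBubbleBound.Negative (e₀)

namespace Summit.CriticalPhenomena.SAWScalingLimit.Theorems.CriticalBubbleBound.Docking

/-! ## A polygon contains no other polygon -/

section Generic

variable {V : Type*} {G : SimpleGraph V}

/-- A self-avoiding path is the only self-avoiding path between its endpoints all of whose edges
are edges of it. [folklore] -/
private theorem eq_of_isPath_of_edges_subset {u v : V} {p : G.Walk u v} (hp : p.IsPath) :
    ∀ {q : G.Walk u v}, q.IsPath → (∀ e ∈ q.edges, e ∈ p.edges) → q = p := by
  induction p with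
  | nil =>
    intro q hq _
    exact ((SimpleGraph.Walk.isPath_iff_nil).1 hq).eq_nil
  | cons hadj p' ih =>
    rename_i u w v
    intro q hq h
    have hp' : p'.IsPath ∧ u ∉ p'.support := (SimpleGraph.Walk.cons_isPath_iff _ _).1 hp
    cases q with
    | nil =>
      exact absurd ((SimpleGraph.Walk.isPath_iff_nil).1 hp) SimpleGraph.Walk.not_nil_cons
    | cons hadj' q' =>
      rename_i w'
      have hq' : q'.IsPath ∧ u ∉ q'.support := (SimpleGraph.Walk.cons_isPath_iff _ _).1 hq
      -- the first edge of `q` is an edge of `p` at `u`, hence the first edge of `p`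
      have hmem : s(u, w') ∈ (SimpleGraph.Walk.cons hadj p').edges :=
        h _ (by rw [SimpleGraph.Walk.edges_cons]; exact List.mem_cons_self)
      rw [SimpleGraph.Walk.edges_cons, List.mem_cons] at hmem
      have hw : w' = w := by
        rcases hmem with he | he
        · exact Sym2.congr_right.1 he
        · exact absurd (p'.fst_mem_support_of_mem_edges he) hp'.2
      subst hw
      have h' : ∀ e ∈ q'.edges, e ∈ p'.edges := fun e he => by
        have h1 := h e (by rw [SimpleGraph.Walk.edges_cons]; exact List.mem_cons_of_mem _ he)
        rw [SimpleGraph.Walk.edges_cons, List.mem_cons] at h1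
        rcases h1 with rfl | h1
        · exact absurd (q'.fst_mem_support_of_mem_edges he) hq'.2
        · exact h1
      rw [ih hp'.1 hq'.1 h']

/-- **A polygon contains no other polygon**: two polygons (edge sets of cycles), one inside the
other, coincide — open both at a common edge and compare the two self-avoiding paths. [folklore] -/
theorem polygon_eq_of_subset [DecidableEq V] {E F : Finset (Sym2 V)} (hE : IsPolygon G E)
    (hF : IsPolygon G F) (h : E ⊆ F) : E = F := by
  obtain ⟨e, he⟩ : E.Nonempty := by
    obtain ⟨u, c, hc, hlen⟩ := hE.exists_length_eq
    have h3 := hc.three_le_length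
    exact Finset.card_pos.1 (by omega)
  induction e using Sym2.ind with
  | _ a b =>
    obtain ⟨P, hP, hPe, -, -, -⟩ := hF.exists_isPath_erase (h he)
    obtain ⟨Q, hQ, hQe, -, -, -⟩ := hE.exists_isPath_erase he
    have hQP : Q = P := eq_of_isPath_of_edges_subset hP hQ fun f hf => by
      have hf' : f ∈ Q.edges.toFinset := List.mem_toFinset.2 hf
      rw [hQe] at hf'
      have hf'' := Finset.erase_subset_erase _ h hf'
      rwa [← hPe, List.mem_toFinset] at hf''
    subst hQP
    rw [← Finset.insert_erase he, ← hQe, hPe, Finset.insert_erase (h he)]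

end Generic

/-! ## Opening a polygon at a translated root edge -/

/-- **Opening at a translated root.** A polygon of `ℤ²` through `{v, v + e₀}` with `n + 1` edges is
the translated rooted polygon `pedges n (shift v χ)` of some `χ ∈ sawFun 2 n e₀` (trace the cycle
minus `{v, v+e₀}` from `v` to `v + e₀` and subtract `v`). [cite: MadrasSlade1993, Definition 3.2.1] -/
theorem exists_sawFun_shift_of_isPolygon {C : Finset (Sym2 (Site 2))} (hC : IsPolygon (zdGraph 2) C)
    {v : Site 2} (hr : s(v, v + e₀) ∈ C) {n : ℕ} (hn : C.card = n + 1) :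
    ∃ χ ∈ Zd.sawFun 2 n e₀, pedges n (shift v χ) = C := by
  classical
  obtain ⟨P, hP, hPe, -, hPl, -⟩ := hC.exists_isPath_erase hr
  have hlen : P.length = n := by omega
  refine ⟨fun i => P.getVert i - v,
    Zd.mem_sawFun.2 ⟨by simp [P.getVert_zero], fun i hi => ?_, fun i hi => ?_, ?_⟩, ?_⟩
  · simp only [P.getVert_of_length_le (hlen ▸ hi), add_sub_cancel_left]
  · exact (Zd.zdGraph_adj_sub_right _ _ v).2 (P.adj_getVert_succ (hlen ▸ hi))
  · intro i hi j hj hij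
    have hinj := hP.getVert_injOn
    rw [hlen] at hinj
    exact hinj hi hj (sub_left_injective hij)
  · have hs : shift v (fun i => P.getVert i - v) = fun i => P.getVert i :=
      funext fun i => sub_add_cancel (P.getVert i) v
    rw [hs, pedges, P.getVert_zero, P.getVert_of_length_le hlen.le, ← hlen,
      image_getVert_eq_edges_toFinset, hPe, Sym2.eq_swap]
    exact Finset.insert_erase hr

/-! ## The unflip of a macroscopic pinch -/

/-- In a pinch of the polygon `P` at the plaquette `q` with flipped pair `(A, B)`, the part `A` does
not contain both horizontal sides of the plaquette: otherwise `B` would be a polygon inside `P`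
missing the edge `{q, q+e₁}` of `P`. [folklore] -/
theorem pinch_not_both {P A B : Finset (Sym2 (Site 2))} {q : Site 2} (hP : IsPolygon (zdGraph 2) P)
    (hB : IsPolygon (zdGraph 2) B) (hAB : ∀ x, (∃ e ∈ A, x ∈ e) → (∃ e ∈ B, x ∈ e) → False)
    (hU : A ∪ B = insert s(q, q + e₀) (insert s(q + e₁, q + e₀ + e₁)
      (((P.erase s(q, q + e₁)).erase s(q + e₀, q + e₀ + e₁)))))
    (hL : s(q, q + e₁) ∈ P) (hlo : s(q, q + e₀) ∈ A) (hhi : s(q + e₁, q + e₀ + e₁) ∈ A) :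
    False := by
  have hBP : B ⊆ P := fun e he => by
    have heU : e ∈ A ∪ B := Finset.mem_union_right _ he
    rw [hU, Finset.mem_insert, Finset.mem_insert] at heU
    rcases heU with rfl | rfl | h
    · exact (notMem_of_vertexDisjoint hAB hlo he).elim
    · exact (notMem_of_vertexDisjoint hAB hhi he).elim
    · exact Finset.mem_of_mem_erase (Finset.mem_of_mem_erase h)
  have hBP' : B = P := polygon_eq_of_subset hB hP hBP
  have hLU : s(q, q + e₁) ∈ A ∪ B := Finset.mem_union_right _ (by rw [hBP']; exact hL)
  rw [hU, Finset.mem_insert, Finset.mem_insert, Finset.mem_erase, Finset.mem_erase] at hLU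
  rcases hLU with h | h | h
  · exact lo_ne_left q h.symm
  · exact hi_ne_left q h.symm
  · exact h.2.1 rfl

/-- **The unflip of a macroscopic pinch.** A pinch plaquette `q ∈ pinches i n χ` of
`χ ∈ sawFun 2 n e₀`, `n ∈ B_{i+1}`, comes from a docking datum: there are `j, k ∈ [2^i, 2^{i+2})`
with `n = j + k + 1`, `ω ∈ sawFun 2 j e₀`, `ω' ∈ sawFun 2 k e₀`, `v ∈ dockings j k ω ω'` and an
orientation bit `o` such that `q = v` (`o = true`: the lower side of the plaquette is the partner's
root) or `q = v - e₁` (`o = false`: the upper side is), and `pedges n χ` is the plaquette flip at `q`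
of `pedges j ω ∪ pedges k (shift v ω')`. [cite: MadrasSlade1993, Definition 3.2.1] -/
theorem pinch_unflip {i n : ℕ} {χ : ℕ → Site 2} {q : Site 2} (hn : n ∈ block (i + 1))
    (hχ : χ ∈ Zd.sawFun 2 n e₀) (hq : q ∈ pinches i n χ) :
    ∃ (j k : ℕ) (ω ω' : ℕ → Site 2) (v : Site 2) (o : Bool),
      j ∈ Finset.Ico (2 ^ i) (2 ^ (i + 2)) ∧ k ∈ Finset.Ico (2 ^ i) (2 ^ (i + 2)) ∧
      ω ∈ Zd.sawFun 2 j e₀ ∧ ω' ∈ Zd.sawFun 2 k e₀ ∧ v ∈ dockings j k ω ω' ∧ n = j + k + 1 ∧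
      (q = if o then v else v - e₁) ∧
      pedges n χ = insert s(q, q + e₁) (insert s(q + e₀, q + e₀ + e₁)
        (((pedges j ω ∪ pedges k (shift v ω')).erase s(q, q + e₀)).erase
          s(q + e₁, q + e₀ + e₁))) := by
  classical
  rw [pinches, Finset.mem_filter] at hq
  obtain ⟨-, hL, hR, hlo, hhi, E₁, E₂, hE₁, hE₂, hdis, hU, hroot, hc₁, hc₂⟩ := hq
  have hn' := hn
  rw [block, Finset.mem_Ico, pow_succ] at hn'
  have hi1 : 1 ≤ 2 ^ i := Nat.one_le_two_pow
  have hn2 : 2 ≤ n := by omega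
  -- the rooted polygon `P = pedges n χ` and the sizes of the two parts
  have hPP := pedges_shift_isPolygon hχ hn2 0
  rw [shift_by_zero] at hPP
  obtain ⟨hP, hPc⟩ := hPP
  have hcardU : (E₁ ∪ E₂).card = n + 1 := by
    have h1 : s(q + e₀, q + e₀ + e₁) ∈ (pedges n χ).erase s(q, q + e₁) :=
      Finset.mem_erase.2 ⟨(left_ne_right q).symm, hR⟩
    have h2 : s(q + e₁, q + e₀ + e₁) ∉
        ((pedges n χ).erase s(q, q + e₁)).erase s(q + e₀, q + e₀ + e₁) :=
      fun h => hhi (Finset.mem_of_mem_erase (Finset.mem_of_mem_erase h))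
    have h3 : s(q, q + e₀) ∉ insert s(q + e₁, q + e₀ + e₁)
        (((pedges n χ).erase s(q, q + e₁)).erase s(q + e₀, q + e₀ + e₁)) := by
      rw [Finset.mem_insert, not_or]
      exact ⟨(hi_ne_lo q).symm,
        fun h => hlo (Finset.mem_of_mem_erase (Finset.mem_of_mem_erase h))⟩
    rw [hU, Finset.card_insert_of_notMem h3, Finset.card_insert_of_notMem h2,
      Finset.card_erase_of_mem h1, Finset.card_erase_of_mem hL, hPc]
    omega
  have hdisj : Disjoint E₁ E₂ :=
    Finset.disjoint_left.2 fun e h1 h2 => notMem_of_vertexDisjoint hdis h1 h2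
  have hsum : E₁.card + E₂.card = n + 1 := by
    rw [← Finset.card_union_of_disjoint hdisj, hcardU]
  obtain ⟨j, hj⟩ : ∃ j, E₁.card = j + 1 := ⟨E₁.card - 1, by omega⟩
  obtain ⟨k, hk⟩ : ∃ k, E₂.card = k + 1 := ⟨E₂.card - 1, by omega⟩
  -- the rooted part
  obtain ⟨ω, hω, hωE⟩ := exists_sawFun_of_isPolygon hE₁ hroot hj
  -- which horizontal side lies in which part
  have key : ∃ (v : Site 2) (o : Bool), s(v, v + e₀) ∈ E₂ ∧ (q = if o then v else v - e₁) ∧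
      ((s(v - e₁, v + e₀ - e₁) ∈ E₁ ∧ s(v - e₁, v + e₀ - e₁) ∉ pedges n χ) ∨
        (s(v + e₁, v + e₀ + e₁) ∈ E₁ ∧ s(v + e₁, v + e₀ + e₁) ∉ pedges n χ)) := by
    have hloU : s(q, q + e₀) ∈ E₁ ∪ E₂ := by rw [hU]; exact Finset.mem_insert_self _ _
    have hhiU : s(q + e₁, q + e₀ + e₁) ∈ E₁ ∪ E₂ := by
      rw [hU]; exact Finset.mem_insert_of_mem (Finset.mem_insert_self _ _)
    have hdis' : ∀ x, (∃ e ∈ E₂, x ∈ e) → (∃ e ∈ E₁, x ∈ e) → False := fun x h h' => hdis x h' h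
    rcases Finset.mem_union.1 hloU with hlo₁ | hlo₂
    · -- the lower side lies in the rooted part, so the upper side is the partner's root
      have hhi₂ : s(q + e₁, q + e₀ + e₁) ∈ E₂ := (Finset.mem_union.1 hhiU).resolve_left
        fun hhi₁ => pinch_not_both hP hE₂ hdis hU hL hlo₁ hhi₁
      refine ⟨q + e₁, false, ?_, by simp, Or.inl ?_⟩
      · rw [add_right_comm q e₁ e₀]; exact hhi₂
      · have h1 : q + e₁ - e₁ = q := add_sub_cancel_right q e₁
        have h2 : q + e₁ + e₀ - e₁ = q + e₀ := by abel
        rw [h1, h2]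
        exact ⟨hlo₁, hlo⟩
    · -- the lower side is the partner's root, so the upper side lies in the rooted part
      have hhi₁ : s(q + e₁, q + e₀ + e₁) ∈ E₁ := (Finset.mem_union.1 hhiU).resolve_right
        fun hhi₂ => pinch_not_both hP hE₁ hdis' (by rw [Finset.union_comm]; exact hU) hL hlo₂ hhi₂
      exact ⟨q, true, hlo₂, by simp, Or.inr ⟨hhi₁, hhi⟩⟩
  obtain ⟨v, o, hvE₂, hqo, hface⟩ := key
  -- the partner
  obtain ⟨ω', hω', hω'E⟩ := exists_sawFun_shift_of_isPolygon hE₂ hvE₂ hk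
  have hrootP : rootEdge ∈ pedges n χ := rootEdge_mem_pedges_of_mem_sawFun hχ
  have hi4 : 2 ^ (i + 2) = 2 ^ i * 4 := by rw [pow_add]; norm_num
  refine ⟨j, k, ω, ω', v, o, ?_, ?_, hω, hω', ?_, by omega, hqo, ?_⟩
  · rw [Finset.mem_Ico]; omega
  · rw [Finset.mem_Ico]; omega
  · -- `v` is a docking of `ω'` against `ω`
    rw [dockings, Finset.mem_filter]
    refine ⟨?_, ?_, ?_⟩
    · rw [Finset.mem_union, Finset.mem_image, Finset.mem_image]
      rcases hface with ⟨hf, -⟩ | ⟨hf, -⟩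
      · refine Or.inl ⟨v - e₁, ?_, sub_add_cancel v e₁⟩
        rw [← exists_mem_pedges_iff, hωE]
        exact ⟨_, hf, Sym2.mem_mk_left _ _⟩
      · refine Or.inr ⟨v + e₁, ?_, add_sub_cancel_right v e₁⟩
        rw [← exists_mem_pedges_iff, hωE]
        exact ⟨_, hf, Sym2.mem_mk_left _ _⟩
    · rw [Finset.disjoint_left]
      intro x hx hx'
      obtain ⟨e, he, hxe⟩ := exists_mem_pedges_iff.2 hx
      obtain ⟨e', he', hxe'⟩ := exists_mem_pedges_iff.2 hx'
      rw [hωE] at he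
      rw [hω'E] at he'
      exact hdis x ⟨e, he, hxe⟩ ⟨e', he', hxe'⟩
    · rw [hωE]
      rcases hface with ⟨hf, hfP⟩ | ⟨hf, hfP⟩
      · exact Or.inl ⟨hf, fun h => hfP (by rw [h]; exact hrootP)⟩
      · exact Or.inr ⟨hf, fun h => hfP (by rw [h]; exact hrootP)⟩
  · -- the inverse flip recovers `pedges n χ`
    rw [hωE, hω'E, hU]
    have h3 : s(q, q + e₀) ∉ insert s(q + e₁, q + e₀ + e₁)
        (((pedges n χ).erase s(q, q + e₁)).erase s(q + e₀, q + e₀ + e₁)) := by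
      rw [Finset.mem_insert, not_or]
      exact ⟨(hi_ne_lo q).symm,
        fun h => hlo (Finset.mem_of_mem_erase (Finset.mem_of_mem_erase h))⟩
    have h2 : s(q + e₁, q + e₀ + e₁) ∉
        ((pedges n χ).erase s(q, q + e₁)).erase s(q + e₀, q + e₀ + e₁) :=
      fun h => hhi (Finset.mem_of_mem_erase (Finset.mem_of_mem_erase h))
    have h1 : s(q + e₀, q + e₀ + e₁) ∈ (pedges n χ).erase s(q, q + e₁) :=
      Finset.mem_erase.2 ⟨(left_ne_right q).symm, hR⟩
    rw [Finset.erase_insert h3, Finset.erase_insert h2, Finset.insert_erase h1,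
      Finset.insert_erase hL]

/-! ## The unflip bound -/

/-- **Stub `pinchMass_le_two_mul_wideDockMass` (the unflip direction).** For every scale `i`,
`pinchMass i ≤ 2 x_c · Σ_{j,k ∈ [2^i,2^{i+2})} Σ_{ω,ω'} |dockings j k ω ω'| x_c^j x_c^k`: the unflip
`(n, χ, q) ↦ (j, k, ω, ω', v, o)` of `pinch_unflip` maps the index set of the finite sum
`pinchMass i` injectively into (docking data with `j, k ∈ [2^i, 2^{i+2})`) `× Bool` and carries the
weight `x_c^n` to `x_c · x_c^j x_c^k`; the remaining terms are nonnegative.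
[cite: MadrasSlade1993, §1.4] -/
theorem pinchMass_le_two_mul_wideDockMass : ∀ i : ℕ, pinchMass i ≤ 2 * criticalFugacity * ∑ j ∈ Finset.Ico (2 ^ i) (2 ^ (i + 2)), ∑ k ∈ Finset.Ico (2 ^ i) (2 ^ (i + 2)), ∑ ω ∈ Zd.sawFun 2 j e₀, ∑ ω' ∈ Zd.sawFun 2 k e₀, ((dockings j k ω ω').card : ℝ) * (criticalFugacity ^ j * criticalFugacity ^ k) := by
  intro i
  classical
  have hx0 : 0 < criticalFugacity := criticalFugacity_pos_lt_one'.1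
  -- the two index finsets
  set I := Finset.Ico (2 ^ i) (2 ^ (i + 2)) with hI
  set T := ((((I ×ˢ I).sigma fun jk : ℕ × ℕ => Zd.sawFun 2 jk.1 e₀ ×ˢ Zd.sawFun 2 jk.2 e₀).sigma
    fun p => dockings p.1.1 p.1.2 p.2.1 p.2.2) ×ˢ (Finset.univ : Finset Bool)) with hT
  set U := ((block (i + 1)).sigma fun n : ℕ => Zd.sawFun 2 n e₀).sigma
    fun p => pinches i p.1 p.2 with hU
  have hL : pinchMass i = ∑ u ∈ U, criticalFugacity ^ u.1.1 := by
    rw [pinchMass, hU, Finset.sum_sigma, Finset.sum_sigma]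
    refine Finset.sum_congr rfl fun n _ => Finset.sum_congr rfl fun χ _ => ?_
    dsimp only
    rw [Finset.sum_const, nsmul_eq_mul]
  have hR : ∑ t ∈ T, criticalFugacity *
        (criticalFugacity ^ t.1.1.1.1 * criticalFugacity ^ t.1.1.1.2) =
      2 * criticalFugacity * ∑ j ∈ I, ∑ k ∈ I, ∑ ω ∈ Zd.sawFun 2 j e₀, ∑ ω' ∈ Zd.sawFun 2 k e₀,
        ((dockings j k ω ω').card : ℝ) * (criticalFugacity ^ j * criticalFugacity ^ k) := by
    rw [hT, Finset.sum_product, Finset.sum_sigma, Finset.sum_sigma, Finset.sum_product,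
      Finset.mul_sum]
    refine Finset.sum_congr rfl fun j _ => ?_
    rw [Finset.mul_sum]
    refine Finset.sum_congr rfl fun k _ => ?_
    rw [Finset.sum_product, Finset.mul_sum]
    refine Finset.sum_congr rfl fun ω _ => ?_
    rw [Finset.mul_sum]
    refine Finset.sum_congr rfl fun ω' _ => ?_
    simp only [Finset.sum_const, Finset.card_univ, Fintype.card_bool, nsmul_eq_mul]
    push_cast
    ring
  -- the unflip, as a relation with an image for every pinch datum
  have himg : ∀ u : (_ : (_ : ℕ) × (ℕ → Site 2)) × Site 2,
      ∃ t : ((_ : (_ : ℕ × ℕ) × ((ℕ → Site 2) × (ℕ → Site 2))) × Site 2) × Bool, u ∈ U →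
        t ∈ T ∧ u.1.1 = t.1.1.1.1 + t.1.1.1.2 + 1 ∧
        (u.2 = if t.2 then t.1.2 else t.1.2 - e₁) ∧
        pedges u.1.1 u.1.2 = insert s(u.2, u.2 + e₁) (insert s(u.2 + e₀, u.2 + e₀ + e₁)
          (((pedges t.1.1.1.1 t.1.1.2.1 ∪ pedges t.1.1.1.2 (shift t.1.2 t.1.1.2.2)).erase
            s(u.2, u.2 + e₀)).erase s(u.2 + e₁, u.2 + e₀ + e₁))) := by
    rintro ⟨⟨n, χ⟩, q⟩
    by_cases hu : (⟨⟨n, χ⟩, q⟩ : (_ : (_ : ℕ) × (ℕ → Site 2)) × Site 2) ∈ U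
    · have hu' := hu
      simp only [hU, Finset.mem_sigma] at hu'
      obtain ⟨⟨hn, hχ⟩, hq⟩ := hu'
      obtain ⟨j, k, ω, ω', v, o, hj, hk, hω, hω', hv, hnjk, hqo, hpe⟩ := pinch_unflip hn hχ hq
      refine ⟨⟨⟨⟨(j, k), (ω, ω')⟩, v⟩, o⟩, fun _ => ⟨?_, hnjk, hqo, hpe⟩⟩
      simp only [hT, Finset.mem_product, Finset.mem_sigma, Finset.mem_univ, and_true]
      exact ⟨⟨⟨hj, hk⟩, hω, hω'⟩, hv⟩
    · exact ⟨⟨⟨⟨(0, 0), (fun _ => 0, fun _ => 0)⟩, 0⟩, true⟩, fun h => (hu h).elim⟩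
  choose Ψ hΨ using himg
  -- injectivity: `(v, o)` give back `q`, the inverse flip gives back `pedges n χ`, hence `χ`
  have hinj : Set.InjOn Ψ ↑U := by
    rintro ⟨⟨n₁, χ₁⟩, q₁⟩ hu₁ ⟨⟨n₂, χ₂⟩, q₂⟩ hu₂ heq
    rw [Finset.mem_coe] at hu₁ hu₂
    obtain ⟨-, hn₁, hq₁, hpe₁⟩ := hΨ _ hu₁
    obtain ⟨-, hn₂, hq₂, hpe₂⟩ := hΨ _ hu₂
    rw [heq] at hn₁ hq₁ hpe₁
    dsimp only at hn₁ hn₂ hq₁ hq₂ hpe₁ hpe₂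
    obtain rfl : n₁ = n₂ := hn₁.trans hn₂.symm
    obtain rfl : q₁ = q₂ := hq₁.trans hq₂.symm
    have hpe : pedges n₁ χ₁ = pedges n₁ χ₂ := hpe₁.trans hpe₂.symm
    simp only [hU, Finset.mem_sigma] at hu₁ hu₂
    have hn' := hu₁.1.1
    rw [block, Finset.mem_Ico, pow_succ] at hn'
    have hi1 : 1 ≤ 2 ^ i := Nat.one_le_two_pow
    have hn2 : 2 ≤ n₁ := by omega
    obtain rfl := eq_of_pedges_shift_eq hu₁.1.2 hu₂.1.2 hn2 (v := 0)
      (by rw [shift_by_zero, shift_by_zero]; exact hpe)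
    rfl
  -- the estimate
  calc pinchMass i = ∑ u ∈ U, criticalFugacity ^ u.1.1 := hL
    _ = ∑ u ∈ U, criticalFugacity *
          (criticalFugacity ^ (Ψ u).1.1.1.1 * criticalFugacity ^ (Ψ u).1.1.1.2) := by
        refine Finset.sum_congr rfl fun u hu => ?_
        rw [(hΨ u hu).2.1]
        ring
    _ = ∑ t ∈ U.image Ψ, criticalFugacity *
          (criticalFugacity ^ t.1.1.1.1 * criticalFugacity ^ t.1.1.1.2) :=
        (Finset.sum_image (f := fun t => criticalFugacity *
          (criticalFugacity ^ t.1.1.1.1 * criticalFugacity ^ t.1.1.1.2)) hinj).symm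
    _ ≤ ∑ t ∈ T, criticalFugacity *
          (criticalFugacity ^ t.1.1.1.1 * criticalFugacity ^ t.1.1.1.2) := by
        refine Finset.sum_le_sum_of_subset_of_nonneg (Finset.image_subset_iff.2 fun u hu =>
          (hΨ u hu).1) fun t _ _ => ?_
        exact mul_nonneg hx0.le (mul_nonneg (pow_nonneg hx0.le _) (pow_nonneg hx0.le _))
    _ = _ := hR

end Summit.CriticalPhenomena.SAWScalingLimit.Theorems.CriticalBubbleBound.Docking

end
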